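import Summits.AtomisticToContinuum.Crystallization.Theses.PalmUnimodularRigidity
import Summits.AtomisticToContinuum.Crystallization.Theorems.MinimiserShells.Negative.LoadBearing
import Summits.AtomisticToContinuum.Crystallization.Theorems.MinimiserShells.Negative.Rootedness
import Literature.Probability.Process.PointStationaryLaw
import Literature.MathematicalPhysics.StatisticalMechanics.RootEnergy
import Literature.MathematicalPhysics.StatisticalMechanics.MuGSC
import Summits.AtomisticToContinuum.Crystallization.Theorems.PalmUnimodularRigidityMinimiserShellsEnergyFloorA
import Summits.AtomisticToContinuum.Crystallization.Theorems.PalmUnimodularRigidityMinimiserShellsEnergyFloorB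
import Summits.AtomisticToContinuum.Crystallization.Theorems.PalmUnimodularRigidityMinimiserShellsEnergyFloorC

/-!
# Energy floor `e_uni ≥ e*` (route item 9229 `UnimodularEnergyLowerBound`), part D: the
# random-grid transport — measurability and the mass sent OUT of the root

Support file for stub `stub_energyFloor` (S2) of line `equilibrium-in-law-surgery` of crux
`MinimiserShells` (stmt-AtomisticToContinuum-9225), which discharges route item
stmt-AtomisticToContinuum-9229 `UnimodularEnergyLowerBound` ("e_uni ≥ e*": every point-stationary
hard-core probability law on rooted configurations of `ℝ³` has mean root energy `E_P[h] ≥ e*`).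

For a mesh `L > 0` and a phase `v ∈ [0,1)³` the root sends to each point of its cell
`rootCell L v` the SHARE `share δ μ (rootCell L v) = (locEnergy + C_δ) / #cell`; the TRANSPORT is
the phase average `transport δ L μ y = ∫_{[0,1)³} 1[y ∈ rootCell L v] · share δ μ (rootCell L v) dv`
(definitions in `…EnergyFloorDefs`).

* SHIFT rules `preimage_sub_rootCell`, `neg_mem_rootCell_iff` and PERIODICITY `rootCell_int_add`;
* `measurable_transport` — `uncurry (transport δ L)` is measurable on `Measure ℝ³ × ℝ³` (so the
  Mecke identity applies), via the truncated s-finite kernel (part B) and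
  `Measurable.lintegral_prod_right'`;
* `lintegral_count_restrict_setLIntegral_comm` — Tonelli between `count|S` (`S` countable) and
  the phase integral, through `tsum`;
* **OUT** (`lintegral_transport_eq`): for a rooted `δ`-hard-core `μ`,
  `∫ transport δ L μ y dμ(y) = ∫_{[0,1)³} ofReal (locEnergy δ μ (rootCell L v) + C_δ) dv`
  (the `#cell` cell-mates each receive one share).
-/

noncomputable section

open MeasureTheory Filter
open scoped ENNReal BigOperators Topology

namespace Summit.AtomisticToContinuum.Crystallization.Theorems.PalmUnimodularRigidityMinimiserShells.EnergyFloor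

open Summit.AtomisticToContinuum.Crystallization.Theorems.MinimiserShells.Negative.Rootedness
  (countable_of_separated)

/-! ## The transport -/

section Transport

open Literature.Probability.Process (IsRootedHardCore count_restrict_singleton_ne_zero_iff
  map_sub_count_restrict)
open Literature.MathematicalPhysics.StatisticalMechanics (lennardJones lennardJones_zero)

variable {δ L : ℝ}

/-- `C_δ ≥ 0`. -/
theorem cst_nonneg (δ : ℝ) : 0 ≤ cst δ := by
  unfold cst; positivity

/-- Membership in the root's cell. -/
theorem mem_rootCell {v z : EuclideanSpace ℝ (Fin 3)} :
    z ∈ rootCell L v ↔ cellIdx L v z = cellIdx L v 0 := Iff.rfl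

/-- The root lies in its cell. -/
theorem zero_mem_rootCell (L : ℝ) (v : EuclideanSpace ℝ (Fin 3)) :
    (0 : EuclideanSpace ℝ (Fin 3)) ∈ rootCell L v := rfl

/-- The root's cell is measurable. -/
theorem measurableSet_rootCell (L : ℝ) (v : EuclideanSpace ℝ (Fin 3)) : MeasurableSet (rootCell L v) :=
  measurableSet_setOf_cellIdx_eq L v 0

/-- The root's cell lies in the closed ball of radius `2L`. -/
theorem rootCell_subset_closedBall (hL : 0 < L) (v : EuclideanSpace ℝ (Fin 3)) :
    rootCell L v ⊆ Metric.closedBall 0 (2 * L) := fun _ hz =>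
  Metric.mem_closedBall.2 (by rw [dist_zero_right]; exact (norm_lt_of_cellIdx_eq_zero hL hz).le)

/-- PERIODICITY of the root's cell in the phase. -/
theorem rootCell_int_add {k : EuclideanSpace ℝ (Fin 3)} (hk : ∀ i, ∃ m : ℤ, k i = m)
    (v : EuclideanSpace ℝ (Fin 3)) : rootCell L (k + v) = rootCell L v :=
  Set.ext fun _ => cellIdx_int_add_eq_iff hk

/-- SHIFT of the root's cell: seen from its point `y`, after the phase shift `-L⁻¹ • y`, the root's
cell is the old cell. -/
theorem preimage_sub_rootCell (hL : L ≠ 0) {v y : EuclideanSpace ℝ (Fin 3)} (hy : y ∈ rootCell L v) :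
    (fun z => z - y) ⁻¹' rootCell L (v - L⁻¹ • y) = rootCell L v := by
  ext z
  simp only [Set.mem_preimage, mem_rootCell]
  have h1 : cellIdx L (v - L⁻¹ • y) (z - y) = cellIdx L v z := by
    rw [cellIdx_sub hL, sub_add_cancel]
  have h2 : cellIdx L (v - L⁻¹ • y) 0 = cellIdx L v y := by
    rw [show (0 : EuclideanSpace ℝ (Fin 3)) = y - y from (sub_self y).symm, cellIdx_sub hL,
      sub_add_cancel]
  rw [h1, h2, mem_rootCell.1 hy]

/-- SHIFT: the old root `-y` lies in the new root's cell at the shifted phase iff `y` lies in the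
old root's cell. -/
theorem neg_mem_rootCell_iff (hL : L ≠ 0) (v y : EuclideanSpace ℝ (Fin 3)) :
    -y ∈ rootCell L (v - L⁻¹ • y) ↔ y ∈ rootCell L v := by
  rw [mem_rootCell, mem_rootCell]
  have h1 : cellIdx L (v - L⁻¹ • y) (-y) = cellIdx L v 0 := by
    rw [show -y = (0 : EuclideanSpace ℝ (Fin 3)) - y from (zero_sub y).symm, cellIdx_sub hL,
      sub_add_cancel]
  have h2 : cellIdx L (v - L⁻¹ • y) 0 = cellIdx L v y := by
    rw [show (0 : EuclideanSpace ℝ (Fin 3)) = y - y from (sub_self y).symm, cellIdx_sub hL,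
      sub_add_cancel]
  rw [h1, h2, eq_comm]

/-! ### Measurability -/

/-- Indicators of measurably parametrised sets applied to measurable functions are jointly
measurable. -/
theorem measurable_indicator_param {α β : Type*} [MeasurableSpace α] [MeasurableSpace β]
    {s : α → Set β} (hs : MeasurableSet {p : α × β | p.2 ∈ s p.1}) {f : α × β → ℝ≥0∞}
    (hf : Measurable f) :
    Measurable fun p : α × β => (s p.1).indicator (fun b => f (p.1, b)) p.2 := by
  classical
  have h : (fun p : α × β => (s p.1).indicator (fun b => f (p.1, b)) p.2) =
      {p : α × β | p.2 ∈ s p.1}.indicator f := by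
    funext p
    simp only [Set.indicator_apply, Set.mem_setOf_eq]
  rw [h]
  exact hf.indicator hs

/-- `(μ, v) ↦ trunc δ μ (rootCell L v)` is jointly measurable. -/
theorem measurable_trunc_rootCell (δ L : ℝ) :
    Measurable fun p : Measure (EuclideanSpace ℝ (Fin 3)) × EuclideanSpace ℝ (Fin 3) =>
      trunc δ p.1 (rootCell L p.2) :=
  measurable_trunc_apply (measurableSet_cellIdx_eq L 0)

/-- `(μ, v) ↦ locPos δ μ (rootCell L v)` is jointly measurable. -/
theorem measurable_locPos_rootCell (δ L : ℝ) :
    Measurable fun p : Measure (EuclideanSpace ℝ (Fin 3)) × EuclideanSpace ℝ (Fin 3) =>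
      locPos δ p.1 (rootCell L p.2) :=
  measurable_lintegral_trunc (k := fun v z =>
    (rootCell L v).indicator (fun z => ENNReal.ofReal (lennardJones ‖z‖)) z)
    (measurable_indicator_param (s := rootCell L) (measurableSet_cellIdx_eq L 0)
      (measurable_ofReal_lennardJones_norm.comp measurable_snd))

/-- `(μ, v) ↦ locNeg δ μ (rootCell L v)` is jointly measurable. -/
theorem measurable_locNeg_rootCell (δ L : ℝ) :
    Measurable fun p : Measure (EuclideanSpace ℝ (Fin 3)) × EuclideanSpace ℝ (Fin 3) =>
      locNeg δ p.1 (rootCell L p.2) :=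
  measurable_lintegral_trunc (k := fun v z =>
    (rootCell L v).indicator (fun z => ENNReal.ofReal (-lennardJones ‖z‖)) z)
    (measurable_indicator_param (s := rootCell L) (measurableSet_cellIdx_eq L 0)
      (measurable_ofReal_neg_lennardJones_norm.comp measurable_snd))

/-- `(μ, v) ↦ locEnergy δ μ (rootCell L v)` is jointly measurable. -/
theorem measurable_locEnergy_rootCell (δ L : ℝ) :
    Measurable fun p : Measure (EuclideanSpace ℝ (Fin 3)) × EuclideanSpace ℝ (Fin 3) =>
      locEnergy δ p.1 (rootCell L p.2) := by
  have h1 : Measurable fun p : Measure (EuclideanSpace ℝ (Fin 3)) × EuclideanSpace ℝ (Fin 3) =>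
      (locPos δ p.1 (rootCell L p.2)).toReal :=
    ENNReal.measurable_toReal.comp (measurable_locPos_rootCell δ L)
  have h2 : Measurable fun p : Measure (EuclideanSpace ℝ (Fin 3)) × EuclideanSpace ℝ (Fin 3) =>
      (locNeg δ p.1 (rootCell L p.2)).toReal :=
    ENNReal.measurable_toReal.comp (measurable_locNeg_rootCell δ L)
  show Measurable fun p : Measure (EuclideanSpace ℝ (Fin 3)) × EuclideanSpace ℝ (Fin 3) =>
      ((locPos δ p.1 (rootCell L p.2)).toReal - (locNeg δ p.1 (rootCell L p.2)).toReal) / 2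
  exact (h1.sub h2).div_const 2

/-- `(μ, v) ↦ share δ μ (rootCell L v)` is jointly measurable. -/
theorem measurable_share_rootCell (δ L : ℝ) :
    Measurable fun p : Measure (EuclideanSpace ℝ (Fin 3)) × EuclideanSpace ℝ (Fin 3) =>
      share δ p.1 (rootCell L p.2) := by
  have h1 : Measurable fun p : Measure (EuclideanSpace ℝ (Fin 3)) × EuclideanSpace ℝ (Fin 3) =>
      ENNReal.ofReal (locEnergy δ p.1 (rootCell L p.2) + cst δ) :=
    ENNReal.measurable_ofReal.comp ((measurable_locEnergy_rootCell δ L).add_const _)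
  show Measurable fun p : Measure (EuclideanSpace ℝ (Fin 3)) × EuclideanSpace ℝ (Fin 3) =>
      ENNReal.ofReal (locEnergy δ p.1 (rootCell L p.2) + cst δ) / trunc δ p.1 (rootCell L p.2)
  exact h1.div (measurable_trunc_rootCell δ L)

/-- The transport integrand, in the variables `((μ, v), y)`, is jointly measurable. -/
theorem measurable_transport_integrand' (δ L : ℝ) :
    Measurable fun q : (Measure (EuclideanSpace ℝ (Fin 3)) × EuclideanSpace ℝ (Fin 3)) ×
        EuclideanSpace ℝ (Fin 3) =>
      (rootCell L q.1.2).indicator (fun _ => share δ q.1.1 (rootCell L q.1.2)) q.2 :=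
  measurable_indicator_param (s := fun a : Measure (EuclideanSpace ℝ (Fin 3)) ×
      EuclideanSpace ℝ (Fin 3) => rootCell L a.2)
    ((measurableSet_cellIdx_eq L 0).preimage (measurable_fst.snd.prodMk measurable_snd))
    ((measurable_share_rootCell δ L).comp measurable_fst)

/-- The transport integrand `((μ, y), v) ↦ 1[y ∈ rootCell L v] · share` is jointly measurable. -/
theorem measurable_transport_integrand (δ L : ℝ) :
    Measurable fun q : (Measure (EuclideanSpace ℝ (Fin 3)) × EuclideanSpace ℝ (Fin 3)) ×
        EuclideanSpace ℝ (Fin 3) =>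
      (rootCell L q.2).indicator (fun _ => share δ q.1.1 (rootCell L q.2)) q.1.2 :=
  (measurable_transport_integrand' δ L).comp
    ((measurable_fst.fst.prodMk measurable_snd).prodMk measurable_fst.snd)

/-- **The transport is jointly measurable** (so the Mecke identity applies to it). -/
theorem measurable_transport (δ L : ℝ) : Measurable (Function.uncurry (transport δ L)) :=
  (measurable_transport_integrand δ L).lintegral_prod_right'

/-- For fixed configuration and point, the transport integrand is measurable in the phase. -/
theorem measurable_transport_integrand_phase (δ L : ℝ) (μ : Measure (EuclideanSpace ℝ (Fin 3)))
    (y : EuclideanSpace ℝ (Fin 3)) :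
    Measurable fun v : EuclideanSpace ℝ (Fin 3) =>
      (rootCell L v).indicator (fun _ => share δ μ (rootCell L v)) y :=
  (measurable_transport_integrand δ L).comp (measurable_prodMk_left (x := (μ, y)))

/-! ### Swapping configuration sums with phase integrals -/

/-- **Tonelli for counting measures of countable sets**: `∑_{y ∈ S} ∫_D F(y, v) dv = ∫_D ∑_{y ∈ S} F(y, v) dv`
(through `tsum`, no s-finiteness of `count|S` needed). -/
theorem lintegral_count_restrict_setLIntegral_comm {S : Set (EuclideanSpace ℝ (Fin 3))}
    (hS : S.Countable) {F : EuclideanSpace ℝ (Fin 3) → EuclideanSpace ℝ (Fin 3) → ℝ≥0∞}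
    (hF : ∀ y, Measurable (F y)) (D : Set (EuclideanSpace ℝ (Fin 3))) :
    ∫⁻ y, (∫⁻ v in D, F y v) ∂((Measure.count : Measure (EuclideanSpace ℝ (Fin 3))).restrict S) =
      ∫⁻ v in D, ∫⁻ y, F y v ∂((Measure.count : Measure (EuclideanSpace ℝ (Fin 3))).restrict S) := by
  have : Countable S := hS.to_subtype
  calc ∫⁻ y, (∫⁻ v in D, F y v) ∂((Measure.count : Measure (EuclideanSpace ℝ (Fin 3))).restrict S)
      = ∑' y : S, ∫⁻ v in D, F y v := lintegral_count_restrict_eq_tsum hS _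
    _ = ∫⁻ v in D, ∑' y : S, F y v :=
        (lintegral_tsum fun y : S => ((hF y).aemeasurable)).symm
    _ = ∫⁻ v in D, ∫⁻ y, F y v ∂((Measure.count : Measure (EuclideanSpace ℝ (Fin 3))).restrict S) :=
        lintegral_congr fun v => (lintegral_count_restrict_eq_tsum hS (fun y => F y v)).symm

/-! ### Mass sent out of the root -/

/-- In a rooted hard-core configuration the root's cell has positive finite mass. -/
theorem trunc_rootCell_ne_zero_ne_top (hδ : 0 < δ) (hL : 0 < L) {μ : Measure (EuclideanSpace ℝ (Fin 3))}
    (hμ : IsRootedHardCore δ μ) (v : EuclideanSpace ℝ (Fin 3)) :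
    trunc δ μ (rootCell L v) ≠ 0 ∧ trunc δ μ (rootCell L v) ≠ ∞ := by
  have hmem := mem_hcClass_of_hc hδ hμ
  rw [trunc_of_mem hmem]
  refine ⟨fun h0 => ?_, (measure_lt_top_of_mem_hcClass hmem (rootCell_subset_closedBall hL v)).ne⟩
  have h1 : μ {0} = 0 := measure_mono_null (Set.singleton_subset_iff.2 (zero_mem_rootCell L v)) h0
  rw [hμ.measure_zero_singleton] at h1
  exact one_ne_zero h1

/-- **OUT**: the total mass sent out of the root of a rooted hard-core configuration is the phase
average of `(local energy + C_δ)` — each cell point receives an equal share, and there are exactly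
`#cell` of them. -/
theorem lintegral_transport_eq (hδ : 0 < δ) (hL : 0 < L) {μ : Measure (EuclideanSpace ℝ (Fin 3))}
    (hμ : IsRootedHardCore δ μ) :
    ∫⁻ y, transport δ L μ y ∂μ =
      ∫⁻ v in phaseDom, ENNReal.ofReal (locEnergy δ μ (rootCell L v) + cst δ) := by
  have hμ' := hμ
  have hmem := mem_hcClass_of_hc hδ hμ
  obtain ⟨S, h0, hsep, rfl⟩ := hμ
  have hS := countable_of_separated hδ hsep
  unfold transport
  refine (lintegral_count_restrict_setLIntegral_comm hS
    (fun y => measurable_transport_integrand_phase δ L _ y) phaseDom).trans ?_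
  refine lintegral_congr fun v => ?_
  rw [lintegral_indicator_const (measurableSet_rootCell L v)]
  obtain ⟨hn0, hntop⟩ := trunc_rootCell_ne_zero_ne_top hδ hL hμ' v
  unfold share
  rw [trunc_of_mem hmem] at hn0 hntop ⊢
  exact ENNReal.div_mul_cancel hn0 hntop

end Transport

end Summit.AtomisticToContinuum.Crystallization.Theorems.PalmUnimodularRigidityMinimiserShells.EnergyFloor

end
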